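import Summits.CriticalPhenomena.PercolationContinuityZ3.Theorems.PercNearOneGluingNoHeavyLowerTailOneCutFiveZeroOnePocket
import Mathlib.Tactic.Linarith
import HarnessLib

/-!
# `NoHeavyLowerTail` (stmt-CriticalPhenomena-4575), |A| = 5 glued rung: the SYMMETRIC form of `Z(3,2)` —
# the exchange may be proved at ANY of the three vertices

Support file (prover seat `prim-ineq-gen-8`, gen 8; `--supports stmt-CriticalPhenomena-4575`).  No definitions, no named facts,
no sorries.  Memo: `run/shared/lean/prim/prim-ineq-gen-8/FINDING-gen8-Z32.md` §1.

`μ = prodBernoulli w` on `Fin n`, observer `o`, vertices `a, b, c`, events `A = {o↔a}`, `B`, `C`, `q_v = μ(o↔v)`, pocket atoms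
`s_a = μ(A B̄ C̄)` (o reaches exactly `a`), `d_bc = μ(Ā B C)` (exactly `b, c`), margins `m_a := d_bc − s_a`, `m_b := d_ac − s_b`,
`m_c := d_ab − s_c`.  The elementary identity

  `m_a − m_b = q_b − q_a`            (`OneCutFive.exchangeMargin_sub_eq`)

(both sides equal `μ(Ā B) − μ(A B̄)`) shows that the margin at the WEAKEST vertex is the LARGEST of the three
(`OneCutFive.pocketExchange_of_le_of_exchange`: `q_a ≤ q_b` and `s_b ≤ d_ac` ⟹ `s_a ≤ d_bc`; this is Kozma–Nitzan's remark (7) in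
the proof of their Theorem 2).  Hence the four-point row `Z(3,2)` (`OneCutFive.ZeroOneThree`, `Σ_v q_v > 2 ⟹ μ{o reaches ≤ 1 of a,b,c} ≤
max cut`) is equivalent to its SYMMETRIC form, free of the argmin bookkeeping:

  (Z-SYM3)  `o,a,b,c` distinct, `q_a + q_b + q_c > 2`  ⟹  NOT ( `s_a > d_bc` ∧ `s_b > d_ac` ∧ `s_c > d_ab` ),

i.e. under `Σ > 2` the three 'exactly one' atoms cannot all beat their complementary 'exactly two' atoms
(`OneCutFive.zeroOneThree_of_exists_exchange`, `OneCutFive.exists_exchange_of_zeroOneThree`).  A prover of `Z(3,2)` may therefore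
establish the exchange at whichever vertex is convenient (e.g. the one with the smallest port weight, or the apex of a glued pair).
HONEST LABEL: toward `|A| = 5` of the one-arm near-critical percolation programme (crux 4575, closed by the CSH route); `Z(3,2)` itself
is OPEN; nothing here asserts it.  [cite: KozmaNitzan2024, proof of Theorem 2, display (7) (p. 8)]
-/

noncomputable section

namespace Summit.CriticalPhenomena.PercolationContinuityZ3.Theorems

open MeasureTheory Set Literature.Probability.LatticeModels Literature.Probability.Percolation
open scoped Classical BigOperators

namespace OneCutFive

variable {n : ℕ}

/-- **The margin identity `m_a − m_b = q_b − q_a`.**  For any three events `A, B, C` of a finite weighted graph's bond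
configuration space: `[μ(Ā B C) − μ(A B̄ C̄)] − [μ(A B̄ C) − μ(Ā B C̄)] = μ(B) − μ(A)` (both sides are `μ(Ā B) − μ(A B̄)`).
[cite: KozmaNitzan2024, proof of Theorem 2, display (7) (p. 8)] -/
theorem exchangeMargin_sub_eq (w : Sym2 (Fin n) → unitInterval) (A B C : Set (BondConfig (Fin n))) :
    ((prodBernoulli w).real {ω | ω ∉ A ∧ ω ∈ B ∧ ω ∈ C} - (prodBernoulli w).real {ω | ω ∈ A ∧ ω ∉ B ∧ ω ∉ C}) -
      ((prodBernoulli w).real {ω | ω ∈ A ∧ ω ∉ B ∧ ω ∈ C} - (prodBernoulli w).real {ω | ω ∉ A ∧ ω ∈ B ∧ ω ∉ C}) =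
      (prodBernoulli w).real B - (prodBernoulli w).real A := by
  set μ := prodBernoulli w with hμ
  have hmeas : ∀ s : Set (BondConfig (Fin n)), MeasurableSet s := fun _ => MeasurableSet.of_discrete
  -- `μ(B) = μ(B ∩ A) + μ(Ā B C) + μ(Ā B C̄)` and `μ(A) = μ(A ∩ B) + μ(A B̄ C) + μ(A B̄ C̄)`
  have hB : μ.real B = μ.real (A ∩ B) + (μ.real {ω | ω ∉ A ∧ ω ∈ B ∧ ω ∈ C} +
      μ.real {ω | ω ∉ A ∧ ω ∈ B ∧ ω ∉ C}) := by
    have h1 : μ.real B = μ.real (B ∩ A) + μ.real (B \ A) := (measureReal_inter_add_sdiff (s := B) (hmeas A)).symm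
    have h2 : μ.real (B \ A) = μ.real {ω | ω ∉ A ∧ ω ∈ B ∧ ω ∈ C} + μ.real {ω | ω ∉ A ∧ ω ∈ B ∧ ω ∉ C} := by
      have hdisj : Disjoint {ω : BondConfig (Fin n) | ω ∉ A ∧ ω ∈ B ∧ ω ∈ C} {ω | ω ∉ A ∧ ω ∈ B ∧ ω ∉ C} := by
        rw [Set.disjoint_left]; rintro ω ⟨_, _, hc⟩ ⟨_, _, hc'⟩; exact hc' hc
      have hunion : ({ω : BondConfig (Fin n) | ω ∉ A ∧ ω ∈ B ∧ ω ∈ C} ∪ {ω | ω ∉ A ∧ ω ∈ B ∧ ω ∉ C}) = B \ A := by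
        ext ω; simp only [mem_union, mem_setOf_eq, mem_sdiff]; tauto
      rw [← hunion, measureReal_union hdisj (hmeas _)]
    rw [h1, h2, Set.inter_comm]
  have hA : μ.real A = μ.real (A ∩ B) + (μ.real {ω | ω ∈ A ∧ ω ∉ B ∧ ω ∈ C} +
      μ.real {ω | ω ∈ A ∧ ω ∉ B ∧ ω ∉ C}) := by
    have h1 : μ.real A = μ.real (A ∩ B) + μ.real (A \ B) := (measureReal_inter_add_sdiff (s := A) (hmeas B)).symm
    have h2 : μ.real (A \ B) = μ.real {ω | ω ∈ A ∧ ω ∉ B ∧ ω ∈ C} + μ.real {ω | ω ∈ A ∧ ω ∉ B ∧ ω ∉ C} := by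
      have hdisj : Disjoint {ω : BondConfig (Fin n) | ω ∈ A ∧ ω ∉ B ∧ ω ∈ C} {ω | ω ∈ A ∧ ω ∉ B ∧ ω ∉ C} := by
        rw [Set.disjoint_left]; rintro ω ⟨_, _, hc⟩ ⟨_, _, hc'⟩; exact hc' hc
      have hunion : ({ω : BondConfig (Fin n) | ω ∈ A ∧ ω ∉ B ∧ ω ∈ C} ∪ {ω | ω ∈ A ∧ ω ∉ B ∧ ω ∉ C}) = A \ B := by
        ext ω; simp only [mem_union, mem_setOf_eq, mem_sdiff]; tauto
      rw [← hunion, measureReal_union hdisj (hmeas _)]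
    rw [h1, h2]
  rw [hB, hA]; ring

/-- **The exchange transfers to the weaker vertex** (the margin at the weakest vertex is the largest): if `μ(o↔a) ≤ μ(o↔b)` and the
exchange holds at `b` (`μ(B Ā C̄) ≤ μ(B̄ A C)`), then it holds at `a` (`μ(A B̄ C̄) ≤ μ(Ā B C)`).
[cite: KozmaNitzan2024, proof of Theorem 2, display (7) (p. 8)] -/
theorem pocketExchange_of_le_of_exchange (w : Sym2 (Fin n) → unitInterval) (o a b c : Fin n)
    (hab : (prodBernoulli w).real (openConn o a) ≤ (prodBernoulli w).real (openConn o b))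
    (hb : (prodBernoulli w).real {ω : BondConfig (Fin n) | ω ∈ openConn o b ∧ ω ∉ openConn o a ∧ ω ∉ openConn o c} ≤
      (prodBernoulli w).real {ω : BondConfig (Fin n) | ω ∉ openConn o b ∧ ω ∈ openConn o a ∧ ω ∈ openConn o c}) :
    (prodBernoulli w).real {ω : BondConfig (Fin n) | ω ∈ openConn o a ∧ ω ∉ openConn o b ∧ ω ∉ openConn o c} ≤
      (prodBernoulli w).real {ω : BondConfig (Fin n) | ω ∉ openConn o a ∧ ω ∈ openConn o b ∧ ω ∈ openConn o c} := by
  have hid := exchangeMargin_sub_eq w (openConn o a) (openConn o b) (openConn o c)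
  -- rewrite the `b`-atoms in the order used by `hid`
  have e1 : {ω : BondConfig (Fin n) | ω ∈ openConn o b ∧ ω ∉ openConn o a ∧ ω ∉ openConn o c} =
      {ω | ω ∉ openConn o a ∧ ω ∈ openConn o b ∧ ω ∉ openConn o c} := by
    ext ω; simp only [mem_setOf_eq]; tauto
  have e2 : {ω : BondConfig (Fin n) | ω ∉ openConn o b ∧ ω ∈ openConn o a ∧ ω ∈ openConn o c} =
      {ω | ω ∈ openConn o a ∧ ω ∉ openConn o b ∧ ω ∈ openConn o c} := by
    ext ω; simp only [mem_setOf_eq]; tauto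
  rw [e1, e2] at hb
  linarith

/-- **`Z(3,2)` from its symmetric form.**  If for every finite weighted graph and distinct `o, a, b, c` with `Σ_v μ(o↔v) > 2` the
exchange `μ(B = {v}) ≤ μ(B = {the other two})` holds at SOME `v ∈ {a,b,c}`, then `ZeroOneThree`.  (By
`pocketExchange_of_le_of_exchange` the exchange at any vertex implies the exchange at the weakest one, and
`zeroOneThree_of_pocketExchange` concludes.) [this work] -/
theorem zeroOneThree_of_exists_exchange
    (hE : ∀ (n : ℕ) (w : Sym2 (Fin n) → unitInterval) (o a b c : Fin n),
      o ≠ a → o ≠ b → o ≠ c → a ≠ b → a ≠ c → b ≠ c →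
      2 < (prodBernoulli w).real (openConn o a) + (prodBernoulli w).real (openConn o b) +
        (prodBernoulli w).real (openConn o c) →
      ((prodBernoulli w).real {ω : BondConfig (Fin n) | ω ∈ openConn o a ∧ ω ∉ openConn o b ∧ ω ∉ openConn o c} ≤
          (prodBernoulli w).real {ω : BondConfig (Fin n) | ω ∉ openConn o a ∧ ω ∈ openConn o b ∧ ω ∈ openConn o c}) ∨
      ((prodBernoulli w).real {ω : BondConfig (Fin n) | ω ∈ openConn o b ∧ ω ∉ openConn o a ∧ ω ∉ openConn o c} ≤
          (prodBernoulli w).real {ω : BondConfig (Fin n) | ω ∉ openConn o b ∧ ω ∈ openConn o a ∧ ω ∈ openConn o c}) ∨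
      ((prodBernoulli w).real {ω : BondConfig (Fin n) | ω ∈ openConn o c ∧ ω ∉ openConn o a ∧ ω ∉ openConn o b} ≤
          (prodBernoulli w).real {ω : BondConfig (Fin n) | ω ∉ openConn o c ∧ ω ∈ openConn o a ∧ ω ∈ openConn o b})) :
    ZeroOneThree := by
  refine zeroOneThree_of_pocketExchange fun n w o a b c hoa hob hoc hab hac hbc hsum hqab hqac => ?_
  rcases hE n w o a b c hoa hob hoc hab hac hbc hsum with h | h | h
  · exact h
  · exact pocketExchange_of_le_of_exchange w o a b c hqab h
  · -- exchange at `c`: transfer to `a` with the roles of `b` and `c` swapped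
    have h' : (prodBernoulli w).real {ω : BondConfig (Fin n) | ω ∈ openConn o c ∧ ω ∉ openConn o a ∧ ω ∉ openConn o b} ≤
        (prodBernoulli w).real {ω : BondConfig (Fin n) | ω ∉ openConn o c ∧ ω ∈ openConn o a ∧ ω ∈ openConn o b} := h
    have hca := pocketExchange_of_le_of_exchange w o a c b hqac h'
    have e1 : {ω : BondConfig (Fin n) | ω ∈ openConn o a ∧ ω ∉ openConn o c ∧ ω ∉ openConn o b} =
        {ω | ω ∈ openConn o a ∧ ω ∉ openConn o b ∧ ω ∉ openConn o c} := by
      ext ω; simp only [mem_setOf_eq]; tauto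
    have e2 : {ω : BondConfig (Fin n) | ω ∉ openConn o a ∧ ω ∈ openConn o c ∧ ω ∈ openConn o b} =
        {ω | ω ∉ openConn o a ∧ ω ∈ openConn o b ∧ ω ∈ openConn o c} := by
      ext ω; simp only [mem_setOf_eq]; tauto
    rw [e1, e2] at hca
    exact hca

/-- **Conversely**, `Z(3,2)` yields the symmetric form (indeed the exchange at the weakest vertex, which is one of the three).
[this work] -/
theorem exists_exchange_of_zeroOneThree (hZ : ZeroOneThree) (w : Sym2 (Fin n) → unitInterval) (o a b c : Fin n)
    (hab : a ≠ b) (hac : a ≠ c) (hbc : b ≠ c)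
    (hsum : 2 < (prodBernoulli w).real (openConn o a) + (prodBernoulli w).real (openConn o b) +
      (prodBernoulli w).real (openConn o c)) :
    ((prodBernoulli w).real {ω : BondConfig (Fin n) | ω ∈ openConn o a ∧ ω ∉ openConn o b ∧ ω ∉ openConn o c} ≤
        (prodBernoulli w).real {ω : BondConfig (Fin n) | ω ∉ openConn o a ∧ ω ∈ openConn o b ∧ ω ∈ openConn o c}) ∨
    ((prodBernoulli w).real {ω : BondConfig (Fin n) | ω ∈ openConn o b ∧ ω ∉ openConn o a ∧ ω ∉ openConn o c} ≤
        (prodBernoulli w).real {ω : BondConfig (Fin n) | ω ∉ openConn o b ∧ ω ∈ openConn o a ∧ ω ∈ openConn o c}) ∨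
    ((prodBernoulli w).real {ω : BondConfig (Fin n) | ω ∈ openConn o c ∧ ω ∉ openConn o a ∧ ω ∉ openConn o b} ≤
        (prodBernoulli w).real {ω : BondConfig (Fin n) | ω ∉ openConn o c ∧ ω ∈ openConn o a ∧ ω ∈ openConn o b}) := by
  set μ := prodBernoulli w with hμ
  -- case split on which vertex is weakest
  by_cases h1 : μ.real (openConn o a) ≤ μ.real (openConn o b)
  · by_cases h2 : μ.real (openConn o a) ≤ μ.real (openConn o c)
    · exact Or.inl (pocketExchange_of_zeroOneThree hZ w o a b c hab hac hbc hsum h1 h2)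
    · -- `c` is the weakest
      push Not at h2
      have hcb : μ.real (openConn o c) ≤ μ.real (openConn o b) := le_trans h2.le h1
      have := pocketExchange_of_zeroOneThree hZ w o c a b hac.symm hbc.symm hab (by linarith) h2.le hcb
      exact Or.inr (Or.inr this)
  · push Not at h1
    by_cases h3 : μ.real (openConn o b) ≤ μ.real (openConn o c)
    · have := pocketExchange_of_zeroOneThree hZ w o b a c hab.symm hbc hac (by linarith) h1.le h3
      exact Or.inr (Or.inl this)
    · push Not at h3
      have hca : μ.real (openConn o c) ≤ μ.real (openConn o a) := le_trans h3.le h1.le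
      have := pocketExchange_of_zeroOneThree hZ w o c a b hac.symm hbc.symm hab (by linarith) hca h3.le
      exact Or.inr (Or.inr this)

end OneCutFive

end Summit.CriticalPhenomena.PercolationContinuityZ3.Theorems

end
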